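import Summits.Ventures.PercRepro.C041ZonePortLemma
import Summits.Ventures.PercRepro.C041CSCount

/-!
# THEOREM R-CS (mine-3's C-041.md §17 (a)) on the zone port problem — the counts, the swap, cases (i) and (iii)
(p6, gen 28)

Setting of `C041ZonePortDefs` / `C041ZonePortLemma` (the zone port problem of THEOREM R; validity `V_∨` = admissible
with a red terminal edge, `12 ∈ E`).  The three COUNTS of a port problem: `validSet` (the valid patterns),
`good₁Set` / `good₂Set` (the valid patterns with `Good₁` / `Good₂`); CONJECTURE (CS) on the port problem is
`CSOr P := CS #valid #Good₁ #Good₂`, i.e. `(#valid − #Good₁ − #Good₂)₊² ≤ #Good₁ · #Good₂` (`C041CSCount`).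

* `phiOr_eq_counts` — the weight sum of THEOREM R is `3·#Good₁ + 3·#Good₂ − 2·#valid`, so (CS) implies THE LEMMA
  `0 ≤ Φ∨ P` by AM–GM (`phiOr_nonneg_of_csOr`);
* `csOr_swap` — (CS) is invariant under the terminal swap (`#valid` unchanged, `#Good₁ ↔ #Good₂`);
* `csOr_of_Z_empty` — no zone: every count is `0`;
* **`csOr_of_forced_gate`** — case (iii): a non-switchable gate carries an edge of some side, and by THE KEY FACT every
  valid pattern is Good on the opposite side, so `#valid ≤ #Good₂` (or `#Good₁`) and the excess vanishes.

Cases (ii), (iv) and the two pure cases are the next modules.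
-/

namespace PercRepro

namespace ZonePort

namespace Problem

open Finset CSCount

variable {V E : Type*}

/-- Valid for `V_∨`: admissible with a red terminal edge. -/
def ValidOr (P : Problem V E) (x : P.Term → Bool) : Prop := P.Adm x ∧ (P.X₁ x ∨ P.X₂ x)

section Basic

variable {P : Problem V E}

open Classical in
/-- The weight as `3·[Good₁] + 3·[Good₂] − 2`. -/
theorem weight_eq_ind (x : P.Term → Bool) :
    P.weight x = 3 * (if P.Good₁ x then 1 else 0) + 3 * (if P.Good₂ x then 1 else 0) - 2 := by
  unfold weight
  split_ifs <;> norm_num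

/-- Validity is unchanged by the swap. -/
theorem validOr_swap (x : P.Term → Bool) : P.swap.ValidOr (P.swapPattern x) ↔ P.ValidOr x :=
  and_congr (adm_swap x) ((or_congr (X₁_swap x) (X₂_swap x)).trans or_comm)

/-- The zones of the swap are reached iff those of `P` are. -/
theorem zonesReached_swap : P.swap.ZonesReached ↔ P.ZonesReached := Iff.rfl

/-- Without zones no pattern is valid. -/
theorem not_validOr_of_Z_empty (hZ : P.Z = ∅) (x : P.Term → Bool) : ¬ P.ValidOr x :=
  fun h => h.2.elim (not_X₁_of_Z_empty hZ x) (not_X₂_of_Z_empty hZ x)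

/-- A non-switchable gate with a 1-edge makes every admissible pattern `Good₂`. -/
theorem good₂_of_forced_gate {x : P.Term → Bool} (hx : P.Adm x) {e : P.Term} (hC : P.IsGate (P.tz e.1))
    (hsw : P.sw (P.tz e.1) = false) (hs : P.ts e.1 = false) : P.Good₂ x := by
  have hred : ∀ f : P.Term, P.tz f.1 = P.tz e.1 → x f = true := fun f hf => red_of_forced hx hsw f hf
  exact good₂_of_red_gate hC hs (hred e rfl) fun f hf _ => hred f hf

/-- A non-switchable gate with a 2-edge makes every admissible pattern `Good₁`. -/
theorem good₁_of_forced_gate {x : P.Term → Bool} (hx : P.Adm x) {e : P.Term} (hC : P.IsGate (P.tz e.1))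
    (hsw : P.sw (P.tz e.1) = false) (hs : P.ts e.1 = true) : P.Good₁ x := by
  have hred : ∀ f : P.Term, P.tz f.1 = P.tz e.1 → x f = true := fun f hf => red_of_forced hx hsw f hf
  exact good₁_of_red_gate hC hs (hred e rfl) fun f hf _ => hred f hf

end Basic

section Counts

variable [Fintype E] [DecidableEq E] [DecidableEq V] (P : Problem V E)

open Classical in
/-- The valid patterns. -/
noncomputable def validSet : Finset (P.Term → Bool) := univ.filter fun x => P.ValidOr x

open Classical in
/-- The valid patterns with `Good₁`. -/
noncomputable def good₁Set : Finset (P.Term → Bool) := univ.filter fun x => P.ValidOr x ∧ P.Good₁ x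

open Classical in
/-- The valid patterns with `Good₂`. -/
noncomputable def good₂Set : Finset (P.Term → Bool) := univ.filter fun x => P.ValidOr x ∧ P.Good₂ x

/-- **CONJECTURE (CS) on a port problem** (C-041.md §17): `(#valid − #Good₁ − #Good₂)₊² ≤ #Good₁ · #Good₂`. -/
def CSOr : Prop := CS #(P.validSet) #(P.good₁Set) #(P.good₂Set)

variable {P}

/-- Membership in the valid patterns. -/
theorem mem_validSet {x : P.Term → Bool} : x ∈ P.validSet ↔ P.ValidOr x := by
  classical
  unfold validSet
  rw [Finset.mem_filter]
  exact and_iff_right (Finset.mem_univ _)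

/-- Membership in `good₁Set`. -/
theorem mem_good₁Set {x : P.Term → Bool} : x ∈ P.good₁Set ↔ P.ValidOr x ∧ P.Good₁ x := by
  classical
  unfold good₁Set
  rw [Finset.mem_filter]
  exact and_iff_right (Finset.mem_univ _)

/-- Membership in `good₂Set`. -/
theorem mem_good₂Set {x : P.Term → Bool} : x ∈ P.good₂Set ↔ P.ValidOr x ∧ P.Good₂ x := by
  classical
  unfold good₂Set
  rw [Finset.mem_filter]
  exact and_iff_right (Finset.mem_univ _)

/-- `good₁Set ⊆ validSet`. -/
theorem good₁Set_subset : P.good₁Set ⊆ P.validSet := fun _ hx => mem_validSet.2 (mem_good₁Set.1 hx).1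

/-- `good₂Set ⊆ validSet`. -/
theorem good₂Set_subset : P.good₂Set ⊆ P.validSet := fun _ hx => mem_validSet.2 (mem_good₂Set.1 hx).1

open Classical in
/-- `good₁Set` is the `Good₁`-filter of the valid patterns. -/
theorem good₁Set_eq_filter : P.good₁Set = P.validSet.filter fun x => P.Good₁ x := by
  classical
  ext x
  rw [mem_good₁Set, Finset.mem_filter, mem_validSet]

open Classical in
/-- `good₂Set` is the `Good₂`-filter of the valid patterns. -/
theorem good₂Set_eq_filter : P.good₂Set = P.validSet.filter fun x => P.Good₂ x := by
  classical
  ext x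
  rw [mem_good₂Set, Finset.mem_filter, mem_validSet]

open Classical in
/-- **The weight sum of THEOREM R through the counts**: `Φ∨ P = 3·#Good₁ + 3·#Good₂ − 2·#valid`. -/
theorem phiOr_eq_counts : P.phiOr = 3 * (#(P.good₁Set) : ℤ) + 3 * #(P.good₂Set) - 2 * #(P.validSet) := by
  unfold phiOr
  rw [← Finset.sum_filter]
  have e : (univ.filter fun x => P.Adm x ∧ (P.X₁ x ∨ P.X₂ x)) = P.validSet := by
    ext x
    rw [Finset.mem_filter, mem_validSet]
    exact and_iff_right (Finset.mem_univ _)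
  rw [e, Finset.sum_congr rfl fun x _ => weight_eq_ind x, Finset.sum_sub_distrib, Finset.sum_add_distrib,
    ← Finset.mul_sum, ← Finset.mul_sum, Finset.sum_boole, Finset.sum_boole, Finset.sum_const, nsmul_eq_mul,
    ← good₁Set_eq_filter, ← good₂Set_eq_filter]
  ring

/-- **(CS) implies THE LEMMA**: `0 ≤ Φ∨ P` by AM–GM. -/
theorem phiOr_nonneg_of_csOr (h : P.CSOr) : 0 ≤ P.phiOr := by
  rw [phiOr_eq_counts]
  have := two_mul_le_of_cs h
  omega

/-! ## The terminal swap -/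

/-- The valid patterns of the swap are as many. -/
theorem card_validSet_swap : #(P.swap.validSet) = #(P.validSet) := by
  refine (Finset.card_equiv P.swapPatternEquiv fun x => ?_).symm
  rw [mem_validSet, mem_validSet, swapPatternEquiv_apply, validOr_swap]

/-- The `Good₁` patterns of the swap are the `Good₂` patterns. -/
theorem card_good₁Set_swap : #(P.swap.good₁Set) = #(P.good₂Set) := by
  refine (Finset.card_equiv P.swapPatternEquiv fun x => ?_).symm
  rw [mem_good₂Set, mem_good₁Set, swapPatternEquiv_apply, validOr_swap, good₁_swap]

/-- The `Good₂` patterns of the swap are the `Good₁` patterns. -/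
theorem card_good₂Set_swap : #(P.swap.good₂Set) = #(P.good₁Set) := by
  refine (Finset.card_equiv P.swapPatternEquiv fun x => ?_).symm
  rw [mem_good₁Set, mem_good₂Set, swapPatternEquiv_apply, validOr_swap, good₂_swap]

/-- **(CS) is invariant under the terminal swap.** -/
theorem csOr_swap : P.swap.CSOr ↔ P.CSOr := by
  unfold CSOr
  rw [card_validSet_swap, card_good₁Set_swap, card_good₂Set_swap]
  exact ⟨cs_comm, cs_comm⟩

/-! ## Case (i): no zone -/

/-- **Case (i)**: without zones (CS) holds (every count is `0`). -/
theorem csOr_of_Z_empty (hZ : P.Z = ∅) : P.CSOr := by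
  apply cs_of_le
  have : P.validSet = ∅ := by
    ext x
    rw [mem_validSet]
    exact ⟨fun h => absurd h (not_validOr_of_Z_empty hZ x), fun h => absurd h (Finset.notMem_empty x)⟩
  rw [this, Finset.card_empty]
  exact Nat.zero_le _

/-! ## Case (iii): a non-switchable gate -/

/-- **Case (iii)**: with a non-switchable gate, (CS) holds — every valid pattern is Good on the side opposite to one
of the gate's edges, so `#valid ≤ #Good₂` or `#valid ≤ #Good₁`. -/
theorem csOr_of_forced_gate {C : Finset V} (hC : P.IsGate C) (hsw : P.sw C = false) : P.CSOr := by
  apply cs_of_le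
  obtain ⟨e, he⟩ := P.hk C hC.mem
  let e' : P.Term := ⟨e, he ▸ hC.mem⟩
  have hC' : P.IsGate (P.tz e'.1) := by
    show P.IsGate (P.tz e)
    rw [he]
    exact hC
  have hsw' : P.sw (P.tz e'.1) = false := by
    show P.sw (P.tz e) = false
    rw [he]
    exact hsw
  cases hs : P.ts e
  · have hsub : P.validSet ⊆ P.good₂Set := fun x hx => by
      rw [mem_validSet] at hx
      rw [mem_good₂Set]
      exact ⟨hx, good₂_of_forced_gate hx.1 hC' hsw' hs⟩
    have := Finset.card_le_card hsub
    omega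
  · have hsub : P.validSet ⊆ P.good₁Set := fun x hx => by
      rw [mem_validSet] at hx
      rw [mem_good₁Set]
      exact ⟨hx, good₁_of_forced_gate hx.1 hC' hsw' hs⟩
    have := Finset.card_le_card hsub
    omega

end Counts

end Problem

end ZonePort

end PercRepro
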